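import Summits.KontsevichZagierPeriods.KontsevichZagierPeriods.Theorems.ValuedFieldSpecialisationCTConstructionCoreLog
import Summits.KontsevichZagierPeriods.KontsevichZagierPeriods.Theorems.ValuedFieldSpecialisationCTConstructionThetaPlumbing
import Summits.KontsevichZagierPeriods.KontsevichZagierPeriods.Theorems.ValuedFieldSpecialisationCTConstructionThetaIterClosedForm
import Summits.KontsevichZagierPeriods.KontsevichZagierPeriods.Theorems.ValuedFieldSpecialisationCTConstructionPermTyped
import Summits.KontsevichZagierPeriods.KontsevichZagierPeriods.Theorems.ValuedFieldSpecialisationCTConstructionLogPowCancellation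
import Summits.KontsevichZagierPeriods.KontsevichZagierPeriods.Theorems.ValuedFieldSpecialisationCTConstructionEtaBoxSpecialFibre
import Summits.KontsevichZagierPeriods.KontsevichZagierPeriods.Theorems.ValuedFieldSpecialisationParametricLiftingElementaryNetFibred

/-!
# Route ValuedFieldSpecialisation — crux `CTConstruction`: the core reduction (dilation elimination), main induction

Helper toward crux stmt-KontsevichZagierPeriods-3495 (`CTConstruction`), line `registered`, reshape r3. MAIN INDUCTION
`coreReduction_main` of the reduction of the class core `stub_specialFibreRigidityOfEval` to PURE
(`stub_pureSpecialFibreRigidity`) and log2-CANCELLATION (`stub_logTwoCancellation`): on the fixed universe of typed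
families `Rep i S` (`…CoreCalculus`), a state `c` (class `D c = Σ c i S • [Rep i S]`) with `D c + G ∈ fibredRelations`,
`(G, y)` a dominated pair, has `y ∈ relations`. Induction on the size of the profile `Λ c = {(p i, b) | c i S ≠ 0,
b ≤ B i − |S|}` (`…CoreLog`: `card_profile_lt`): empty support — PURE; a pure-log pair present (invariant: log pairs
have `S ≠ univ`) — apply `(Θ − 1)^{b*}` (`…ThetaPlumbing`, `…ThetaIterClosedForm`): the log block collapses to the top
constant families (`stub_etaBox_specialFibre`), the induction hypothesis on the power part, `logStep_extract` and
`logStep_peel` (`…CoreLog`) remove the top log terms; otherwise — apply `(Θ − 2^{p*})`, recurse and divide by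
`2^{p*} − 1` (`mem_relations_of_zsmul_mem`). Sources: M. Kontsevich, D. Zagier, *Periods* (2001), §1.2; the encoding is
this route's. No definitions.
-/


noncomputable section

namespace Summit.KontsevichZagierPeriods.ValuedFieldSpecialisation

open MeasureTheory Set Filter
open scoped Topology
open Literature.NumberTheory.Transcendental Literature.NumberTheory.Transcendental.KZ
open Summit.KontsevichZagierPeriods.HeckeMultiplicityOne (mem_relations_of_zsmul_mem)

section Main

variable {Q : ℕ} (hQ : 0 < Q) (hPURE : ∀ (G y : Literature.NumberTheory.Transcendental.KZ.FormalRep), (G, y) ∈ AddSubgroup.closure {v : Literature.NumberTheory.Transcendental.KZ.FormalRep × Literature.NumberTheory.Transcendental.KZ.FormalRep | ∃ (n : ℕ) (S : Literature.NumberTheory.Transcendental.KZ.IntegralRep (n + 1)) (r₀ g : Literature.NumberTheory.Transcendental.KZ.IntegralRep n), Literature.NumberTheory.Transcendental.KZ.IsDominatedFamily S r₀ g ∧ v = (Literature.NumberTheory.Transcendental.KZ.of S, Literature.NumberTheory.Transcendental.KZ.of r₀)} → G ∈ Literature.NumberTheory.Transcendental.KZ.fibredRelations → y ∈ Literature.NumberTheory.Transcendental.KZ.relations)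 (hL2C : ∀ (L : Literature.NumberTheory.Transcendental.KZ.IntegralRep 1), L.domain = {t | (1 / 2 : ℝ) ≤ t 0 ∧ t 0 ≤ 1} → L.integrand = (fun t => (t 0)⁻¹) → ∀ c : Literature.NumberTheory.Transcendental.KZ.FormalRep, Literature.NumberTheory.Transcendental.KZ.of L * c ∈ Literature.NumberTheory.Transcendental.KZ.relations → c ∈ Literature.NumberTheory.Transcendental.KZ.relations)
  {k : ℕ} {p B d : Fin k → ℕ} {r : (i : Fin k) → IntegralRep (d i)}
  {Rep : (i : Fin k) → Finset (Fin (B i)) → IntegralRep (B i + d i + 1 + 1)}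
  (hRd : ∀ (i : Fin k) (S : Finset (Fin (B i))), (Rep i S).domain = {z | ∃ (s u : ℝ) (t : Fin (B i) → ℝ) (w : Fin (d i) → ℝ), z = Matrix.vecCons s (Matrix.vecCons u (Fin.append t w)) ∧ 0 < s ∧ s < 1 ∧ 0 < u ∧ u ^ Q * s ^ p i < 1 ∧ (∀ j, ((if j ∈ S then (1 / 2 : ℚ) ^ Q else 1 : ℚ) : ℝ) * s ^ (if j ∈ S then 0 else 1) ≤ t j ∧ t j ≤ 1) ∧ w ∈ (r i).domain})
  (hRi : ∀ (i : Fin k) (S : Finset (Fin (B i))), (Rep i S).integrand = (fun z => (∏ j : Fin (B i), (z (Fin.castAdd (d i) j).succ.succ)⁻¹) * (r i).integrand (fun l : Fin (d i) => z (Fin.natAdd (B i) l).succ.succ)))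
  {T : (Σ n, IntegralRep n) → FormalRep} (hT0 : ∀ ρ : IntegralRep 0, T ⟨0, ρ⟩ = 0)
  (hT : ∀ (n : ℕ) (ρ : IntegralRep (n + 1)), ∃ ρ' : IntegralRep (n + 1), T ⟨n + 1, ρ⟩ = of ρ' ∧
    ρ'.domain = {z | Function.update z 0 ((((1 / 2 : ℚ) ^ Q : ℚ) : ℝ) * z 0) ∈ ρ.domain} ∧
    ρ'.integrand = fun z => ρ.integrand (Function.update z 0 ((((1 / 2 : ℚ) ^ Q : ℚ) : ℝ) * z 0)))

include hQ hPURE hL2C hRd hRi hT0 hT in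
/-- **Main induction of the core reduction** (see the module docstring). [folklore] -/
theorem coreReduction_main :
    ∀ (c : (i : Fin k) → Finset (Fin (B i)) → ℤ),
      (∀ i S, p i = 0 → c i S ≠ 0 → S ≠ Finset.univ) →
      ∀ (G y : FormalRep), (G, y) ∈ AddSubgroup.closure {v : Literature.NumberTheory.Transcendental.KZ.FormalRep × Literature.NumberTheory.Transcendental.KZ.FormalRep | ∃ (n : ℕ) (S : Literature.NumberTheory.Transcendental.KZ.IntegralRep (n + 1)) (r₀ g : Literature.NumberTheory.Transcendental.KZ.IntegralRep n), Literature.NumberTheory.Transcendental.KZ.IsDominatedFamily S r₀ g ∧ v = (Literature.NumberTheory.Transcendental.KZ.of S, Literature.NumberTheory.Transcendental.KZ.of r₀)} →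
        (∑ i, ∑ S : Finset (Fin (B i)), c i S • of (Rep i S)) + G ∈ fibredRelations → y ∈ relations := by
  classical
  have hμ : (0 : ℚ) < (1 / 2 : ℚ) ^ Q := half_pow_pos Q
  have hμ1 : (1 / 2 : ℚ) ^ Q ≤ 1 := half_pow_le_one Q
  have hΘmem : ∀ x ∈ fibredRelations, slabMap 0 1 (FreeAbelianGroup.lift T x) ∈ fibredRelations :=
    fun x hx => theta_mem_fibredRelations hμ T hT0 hT hx
  -- the profile of a state
  let lvl : (Σ i, Finset (Fin (B i))) → ℕ := fun x => B x.1 - x.2.card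
  let supp : ((i : Fin k) → Finset (Fin (B i)) → ℤ) → Finset (Σ i, Finset (Fin (B i))) := fun c =>
    Finset.univ.sigma fun i => Finset.univ.filter fun S => c i S ≠ 0
  let Λ : ((i : Fin k) → Finset (Fin (B i)) → ℤ) → Finset (ℕ × ℕ) := fun c =>
    (supp c).biUnion fun x => (Finset.range (lvl x + 1)).image fun b => (p x.1, b)
  have hsupp : ∀ c (x : Σ i, Finset (Fin (B i))), x ∈ supp c ↔ c x.1 x.2 ≠ 0 := by
    intro c x; simp [supp]
  have hΛ : ∀ c q b, (q, b) ∈ Λ c ↔ ∃ x : Σ i, Finset (Fin (B i)), c x.1 x.2 ≠ 0 ∧ p x.1 = q ∧ b ≤ lvl x :=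
    fun c q b => mem_profile_iff c q b
  have hcard : ∀ c c' : (i : Fin k) → Finset (Fin (B i)) → ℤ,
      (∀ i U, c' i U ≠ 0 → ∃ S, S ⊆ U ∧ c i S ≠ 0) → (∃ q b, (q, b) ∈ Λ c ∧ (q, b) ∉ Λ c') →
      (Λ c').card < (Λ c).card := fun c c' hdom hlost => card_profile_lt c c' hdom hlost
  -- class of a state and its linearity
  let D : ((i : Fin k) → Finset (Fin (B i)) → ℤ) → FormalRep := fun c => ∑ i, ∑ S : Finset (Fin (B i)), c i S • of (Rep i S)
  have hDsub : ∀ c c' : (i : Fin k) → Finset (Fin (B i)) → ℤ,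
      D (fun i S => c i S - c' i S) = D c - D c' := fun c c' => D_sub c c'
  have hDsum : ∀ {ι : Type} (s : Finset ι) (f : ι → (i : Fin k) → Finset (Fin (B i)) → ℤ),
      D (fun i S => ∑ n ∈ s, f n i S) = ∑ n ∈ s, D (f n) := fun s f => D_sum s f
  have hDmul : ∀ (a : ℤ) (c : (i : Fin k) → Finset (Fin (B i)) → ℤ), D (fun i S => a * c i S) = a • D c :=
    fun a c => D_mul a c
  -- induction on the size of the profile
  suffices H : ∀ (N : ℕ) (c : (i : Fin k) → Finset (Fin (B i)) → ℤ), (Λ c).card ≤ N →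
      (∀ i S, p i = 0 → c i S ≠ 0 → S ≠ Finset.univ) →
      ∀ (G y : FormalRep), (G, y) ∈ AddSubgroup.closure {v : Literature.NumberTheory.Transcendental.KZ.FormalRep × Literature.NumberTheory.Transcendental.KZ.FormalRep | ∃ (n : ℕ) (S : Literature.NumberTheory.Transcendental.KZ.IntegralRep (n + 1)) (r₀ g : Literature.NumberTheory.Transcendental.KZ.IntegralRep n), Literature.NumberTheory.Transcendental.KZ.IsDominatedFamily S r₀ g ∧ v = (Literature.NumberTheory.Transcendental.KZ.of S, Literature.NumberTheory.Transcendental.KZ.of r₀)} →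
        D c + G ∈ fibredRelations → y ∈ relations by
    intro c hInv G y hGy hF
    exact H _ c le_rfl hInv G y hGy hF
  intro N
  induction N with
  | zero =>
    intro c hN hInv G y hGy hF
    -- empty profile: no support, `D c = 0`, PURE
    have hc0 : ∀ i S, c i S = 0 := by
      intro i S; by_contra h
      have : (p i, 0) ∈ Λ c := (hΛ c (p i) 0).mpr ⟨⟨i, S⟩, h, rfl, Nat.zero_le _⟩
      rw [Nat.le_zero, Finset.card_eq_zero] at hN
      simp [hN] at this
    have hD0 : D c = 0 := by simp [D, hc0]
    rw [hD0, zero_add] at hF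
    exact hPURE G y hGy hF
  | succ N ih =>
    intro c hN hInv G y hGy hF
    by_cases hzero : ∀ i S, c i S = 0
    · have hD0 : D c = 0 := by simp [D, hzero]
      rw [hD0, zero_add] at hF
      exact hPURE G y hGy hF
    push Not at hzero
    by_cases hlog : ∃ i S, c i S ≠ 0 ∧ p i = 0
    · /- LOG STEP -/
      obtain ⟨iL, SL, hcL, hpL⟩ := hlog
      -- a top log pair and the top level `b*`
      obtain ⟨xs, hxs, hmax⟩ := Finset.exists_max_image ((supp c).filter fun x => p x.1 = 0) lvl
        ⟨⟨iL, SL⟩, by simp [hsupp, hcL, hpL]⟩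
      rw [Finset.mem_filter, hsupp] at hxs
      set bs := lvl xs with hbs
      have hcard_le : ∀ (i : Fin k) (U : Finset (Fin (B i))), U.card ≤ B i := fun i U => by
        simpa using Finset.card_le_univ U
      have hbs_pos : 0 < bs := by
        have hne := hInv xs.1 xs.2 hxs.2 hxs.1
        have hlt : xs.2.card < B xs.1 := by
          refine lt_of_le_of_ne (hcard_le _ _) fun heq => hne ?_
          exact Finset.eq_univ_of_card _ (by simpa using heq)
        simp only [hbs, lvl]
        omega
      have hlvl : ∀ i S, c i S ≠ 0 → p i = 0 → B i - S.card ≤ bs :=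
        fun i S hS hpi => hmax ⟨i, S⟩ (by simp [hsupp, hS, hpi])
      -- the coefficient operator, its iterates, and the state `c₂ = (Θ̂ − 1)^{b*} c`
      let Th : ((i : Fin k) → Finset (Fin (B i)) → ℤ) → ((i : Fin k) → Finset (Fin (B i)) → ℤ) :=
        fun c' i U => ((2 ^ p i : ℕ) * ∑ S ∈ U.powerset, c' i S : ℤ)
      let a : ℕ → ℤ := fun n => (-1 : ℤ) ^ (bs - n) * (bs.choose n : ℤ)
      let c₂ : (i : Fin k) → Finset (Fin (B i)) → ℤ := fun i U =>
        ∑ n ∈ Finset.range (bs + 1), a n * Nat.iterate Th n c i U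
      have hsupp₂ : ∀ i U, c₂ i U ≠ 0 → ∃ S, S ⊆ U ∧ c i S ≠ 0 := fun i U hU => logBlock_supp c bs i U hU
      have heval : ∀ i U, p i = 0 → c₂ i U =
          (bs.factorial : ℤ) * ∑ S ∈ U.powerset.filter (fun S => (U \ S).card = bs), c i S :=
        fun i U hpi => logBlock_eval c bs hlvl i U hpi
      have heval0 : ∀ i U, p i = 0 → U ≠ Finset.univ → c₂ i U = 0 :=
        fun i U hpi hU => logBlock_eval_zero c bs hlvl i U hpi hU
      -- the power part of `c₂`
      let cP : (i : Fin k) → Finset (Fin (B i)) → ℤ := fun i U => if p i = 0 then 0 else c₂ i U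
      have hsuppP : ∀ i U, cP i U ≠ 0 → ∃ S, S ⊆ U ∧ c i S ≠ 0 := by
        intro i U hU
        by_cases hpi : p i = 0
        · simp [cP, hpi] at hU
        · simp only [cP, hpi, if_false] at hU
          exact hsupp₂ i U hU
      have hInvP : ∀ i S, p i = 0 → cP i S ≠ 0 → S ≠ Finset.univ := by
        intro i S hpi hS; simp [cP, hpi] at hS
      have hltP : (Λ cP).card < (Λ c).card := by
        refine hcard c cP hsuppP ⟨0, bs, (hΛ c 0 bs).mpr ⟨xs, hxs.1, hxs.2, le_rfl⟩, fun hmem => ?_⟩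
        rw [hΛ] at hmem
        obtain ⟨⟨i, U⟩, hU, hpi, -⟩ := hmem
        simp [cP, hpi] at hU
      have hDsplit : D c₂ = D cP + ∑ i, if p i = 0 then c₂ i Finset.univ • of (Rep i Finset.univ) else 0 := by
        simp only [D]
        rw [← Finset.sum_add_distrib]
        refine Finset.sum_congr rfl fun i _ => ?_
        by_cases hpi : p i = 0
        · rw [if_pos hpi]
          have h0 : ∑ U : Finset (Fin (B i)), cP i U • of (Rep i U) = 0 :=
            Finset.sum_eq_zero fun U _ => by simp [cP, hpi]
          rw [h0, zero_add]
          rw [Finset.sum_eq_single_of_mem Finset.univ (Finset.mem_univ _) (fun U _ hU => ?_)]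
          rw [heval0 i U hpi hU, zero_smul]
        · rw [if_neg hpi, add_zero]
          refine Finset.sum_congr rfl fun U _ => ?_
          simp [cP, hpi]
      -- special fibres of the constant families `Rep i univ` (log generators)
      have hV : ∀ i, p i = 0 → ∃ (V : IntegralRep (B i + d i + 1)) (Lb : IntegralRep (B i)),
          IsDominatedFamily (Rep i Finset.univ) V V.abs ∧
          Lb.domain = {t | ∀ j, ((((1 / 2 : ℚ) ^ Q : ℚ)) : ℝ) ≤ t j ∧ t j ≤ 1} ∧
          Lb.integrand = (fun t => ∏ j, (t j)⁻¹) ∧ of V - of Lb * of (r i) ∈ relations := by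
        intro i hpi
        exact stub_etaBox_specialFibre Q (p i) (B i) (d i) ((1 / 2 : ℚ) ^ Q)
          (fun j => if j ∈ (Finset.univ : Finset (Fin (B i))) then (1 / 2 : ℚ) ^ Q else 1)
          (fun j => if j ∈ (Finset.univ : Finset (Fin (B i))) then 0 else 1) (r i) (Rep i Finset.univ) hQ hpi hμ hμ1
          (fun j => by simp) (fun j => by simp) (hRd i Finset.univ) (hRi i Finset.univ)
      choose V Lb hVdom hLbd hLbi hVL using hV
      -- the transformed relation `(Θ − 1)^{b*} (D c + G)`
      set θ : FormalRep → FormalRep := fun v => slabMap 0 1 (FreeAbelianGroup.lift T v) with hθ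
      let G₂ : FormalRep := ∑ n ∈ Finset.range (bs + 1), a n • Nat.iterate θ n G
      have hG₂ : (G₂, (0 : FormalRep)) ∈ AddSubgroup.closure {v : Literature.NumberTheory.Transcendental.KZ.FormalRep × Literature.NumberTheory.Transcendental.KZ.FormalRep | ∃ (n : ℕ) (S : Literature.NumberTheory.Transcendental.KZ.IntegralRep (n + 1)) (r₀ g : Literature.NumberTheory.Transcendental.KZ.IntegralRep n), Literature.NumberTheory.Transcendental.KZ.IsDominatedFamily S r₀ g ∧ v = (Literature.NumberTheory.Transcendental.KZ.of S, Literature.NumberTheory.Transcendental.KZ.of r₀)} := by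
        have h := altSum_thetaIter_mem_closure_dominatedPairs hμ T hT bs hGy
        rw [if_neg hbs_pos.ne'] at h
        exact h
      have hDc₂ : D c₂ = ∑ n ∈ Finset.range (bs + 1), a n • D (Nat.iterate Th n c) := by
        have h1 : c₂ = fun i U => ∑ n ∈ Finset.range (bs + 1), (fun n i U => a n * Nat.iterate Th n c i U) n i U := rfl
        rw [h1, hDsum]
        refine Finset.sum_congr rfl fun n _ => ?_
        exact hDmul (a n) _
      have hF₂ : D c₂ + G₂ ∈ fibredRelations := by
        have h1 := altSum_thetaIter_mem_fibredRelations hμ T hT0 hT bs hF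
        have h2 : (∑ n ∈ Finset.range (bs + 1), a n • (Nat.iterate θ n (D c) - D (Nat.iterate Th n c))) ∈
            fibredRelations :=
          fibredRelations.sum_mem fun n _ =>
            fibredRelations.zsmul_mem (thetaIter_D_sub_D_mem hRd hRi hT hΘmem n c) _
        have h3 := fibredRelations.sub_mem h1 h2
        convert h3 using 1
        rw [hDc₂, ← Finset.sum_sub_distrib, ← Finset.sum_add_distrib]
        refine Finset.sum_congr rfl fun n _ => ?_
        rw [← smul_add, ← smul_sub]
        congr 1
        have : Nat.iterate θ n (D c + G) = Nat.iterate θ n (D c) + Nat.iterate θ n G := by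
          have h := thetaIter_sub (T := T) n (D c + G) G
          simp only [add_sub_cancel_right] at h
          rw [← hθ] at h
          rw [h]; abel
        rw [this]; abel
      -- the induction hypothesis on the power part
      have hGy₂ : ((∑ i, if p i = 0 then c₂ i Finset.univ • of (Rep i Finset.univ) else 0) + G₂,
          (∑ i, if h : p i = 0 then c₂ i Finset.univ • of (V i h) else 0) + 0) ∈
          AddSubgroup.closure {v : Literature.NumberTheory.Transcendental.KZ.FormalRep × Literature.NumberTheory.Transcendental.KZ.FormalRep | ∃ (n : ℕ) (S : Literature.NumberTheory.Transcendental.KZ.IntegralRep (n + 1)) (r₀ g : Literature.NumberTheory.Transcendental.KZ.IntegralRep n), Literature.NumberTheory.Transcendental.KZ.IsDominatedFamily S r₀ g ∧ v = (Literature.NumberTheory.Transcendental.KZ.of S, Literature.NumberTheory.Transcendental.KZ.of r₀)} := by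
        rw [← Prod.mk_add_mk]
        refine AddSubgroup.add_mem _ ?_ hG₂
        have hpair : ((∑ i, if p i = 0 then c₂ i Finset.univ • of (Rep i Finset.univ) else 0),
            (∑ i, if h : p i = 0 then c₂ i Finset.univ • of (V i h) else 0)) =
            ∑ i, (if h : p i = 0 then c₂ i Finset.univ • (of (Rep i Finset.univ), of (V i h)) else 0) := by
          rw [prod_mk_sum]
          refine Finset.sum_congr rfl fun i _ => ?_
          split_ifs <;> simp
        rw [hpair]
        refine AddSubgroup.sum_mem _ fun i _ => ?_
        split_ifs with h
        · refine AddSubgroup.zsmul_mem _ ?_ _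
          exact AddSubgroup.subset_closure ⟨_, Rep i Finset.univ, V i h, (V i h).abs, hVdom i h, rfl⟩
        · exact AddSubgroup.zero_mem _
      have hFP : D cP + ((∑ i, if p i = 0 then c₂ i Finset.univ • of (Rep i Finset.univ) else 0) + G₂) ∈
          fibredRelations := by
        rw [← add_assoc, ← hDsplit]; exact hF₂
      have hy₂ := ih cP (Nat.lt_succ_iff.mp (lt_of_lt_of_le hltP hN)) hInvP _ _ hGy₂ hFP
      rw [add_zero] at hy₂
      -- the top coefficient sums and the extraction of the box coefficient
      let t : Fin k → ℤ := fun i => if p i = 0 then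
        ∑ S ∈ (Finset.univ : Finset (Fin (B i))).powerset.filter (fun S => (Finset.univ \ S).card = bs), c i S else 0
      have ht : ∀ i, t i ≠ 0 → p i = 0 ∧ bs ≤ B i := by
        intro i hti
        by_cases hpi : p i = 0
        · refine ⟨hpi, ?_⟩
          simp only [t, hpi, if_true] at hti
          obtain ⟨S, hS, -⟩ := Finset.exists_ne_zero_of_sum_ne_zero hti
          rw [Finset.mem_filter] at hS
          rw [← hS.2]
          exact hcard_le i _
        · simp [t, hpi] at hti
      have hy_t : (∑ i, if h : p i = 0 then ((bs.factorial : ℤ) * t i) • of (V i h) else 0) ∈ relations := by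
        convert hy₂ using 1
        refine Finset.sum_congr rfl fun i _ => ?_
        split_ifs with h
        · rw [heval i _ h]; simp [t, h]
        · rfl
      obtain ⟨hboxes, -, -⟩ := stub_logPowCancellation_of_logTwo Q hQ
      choose L hLd hLi using hboxes
      have hX := logStep_extract hQ hLd hLi hL2C t ht V Lb hLbd hLbi hVL hy_t
      have hX' : (∑ i, if p i = 0 ∧ bs ≤ B i then
          (∑ S ∈ (Finset.univ : Finset (Fin (B i))).powerset.filter (fun S => (Finset.univ \ S).card = bs), c i S) •
            of ((L (B i - bs)).prod (r i)) else 0) ∈ relations := by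
        convert hX using 1
        refine Finset.sum_congr rfl fun i _ => ?_
        split_ifs with h
        · simp [t, h.1]
        · rfl
      -- peel the top log terms
      have hpeel := logStep_peel hQ hRd hRi hbs_pos hLd hLi c hX'
      let c₁ : (i : Fin k) → Finset (Fin (B i)) → ℤ := fun i S =>
        if p i = 0 ∧ (Finset.univ \ S).card = bs then 0 else c i S
      have hDc₁ : D c = D c₁ +
          ∑ i, ∑ S : Finset (Fin (B i)), (if p i = 0 ∧ (Finset.univ \ S).card = bs then c i S else 0) • of (Rep i S) := by
        simp only [D]
        rw [← Finset.sum_add_distrib]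
        refine Finset.sum_congr rfl fun i _ => ?_
        rw [← Finset.sum_add_distrib]
        refine Finset.sum_congr rfl fun S _ => ?_
        rw [← add_smul]
        congr 1
        simp only [c₁]
        split_ifs <;> simp
      have hF₁ : D c₁ + G ∈ fibredRelations := by
        have := fibredRelations.sub_mem hF hpeel
        convert this using 1
        rw [hDc₁]; abel
      have hInv₁ : ∀ i S, p i = 0 → c₁ i S ≠ 0 → S ≠ Finset.univ := by
        intro i S hpi hS
        apply hInv i S hpi
        simp only [c₁] at hS
        split_ifs at hS with h
        · exact absurd rfl hS
        · exact hS
      have hsupp₁ : ∀ i U, c₁ i U ≠ 0 → ∃ S, S ⊆ U ∧ c i S ≠ 0 := by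
        intro i U hU
        refine ⟨U, subset_rfl, ?_⟩
        simp only [c₁] at hU
        split_ifs at hU with h
        · exact absurd rfl hU
        · exact hU
      have hlt₁ : (Λ c₁).card < (Λ c).card := by
        refine hcard c c₁ hsupp₁ ⟨0, bs, (hΛ c 0 bs).mpr ⟨xs, hxs.1, hxs.2, le_rfl⟩, fun hmem => ?_⟩
        rw [hΛ] at hmem
        obtain ⟨⟨i, U⟩, hU, hpi, hb⟩ := hmem
        simp only [c₁] at hU
        split_ifs at hU with hcond
        · exact hU rfl
        · have h1 := hlvl i U hU hpi
          have h2 : (Finset.univ \ U).card = B i - U.card := by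
            rw [Finset.card_sdiff_of_subset (Finset.subset_univ U)]; simp
          simp only [lvl] at hb
          exact hcond ⟨hpi, by omega⟩
      exact ih c₁ (Nat.lt_succ_iff.mp (lt_of_lt_of_le hlt₁ hN)) hInv₁ G y hGy hF₁
    · /- POWER STEP -/
      push Not at hlog
      obtain ⟨i₀, S₀, hi₀⟩ := hzero
      set pstar := p i₀ with hpstar
      have hpstar_pos : 0 < pstar := Nat.pos_of_ne_zero (hlog i₀ S₀ hi₀)
      -- the new state `c' = Θ̂ c − 2^{p*} c`
      let c' : (i : Fin k) → Finset (Fin (B i)) → ℤ := fun i U =>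
        ((2 ^ p i : ℕ) * ∑ S ∈ U.powerset, c i S : ℤ) - (2 ^ pstar : ℕ) * c i U
      have hDc' : slabMap 0 1 (FreeAbelianGroup.lift T (D c)) - (2 ^ pstar : ℕ) • D c - D c' ∈ fibredRelations := by
        have h1 := theta_D_sub_D_mem hRd hRi hT c
        have h2 : D c' = (∑ i, ∑ U : Finset (Fin (B i)), ((2 ^ p i : ℕ) * ∑ S ∈ U.powerset, c i S : ℤ) • of (Rep i U)) -
            ((2 ^ pstar : ℕ) : ℤ) • D c := by
          rw [← hDmul]
          rw [← hDsub]
        rw [h2, natCast_zsmul]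
        convert h1 using 1
        abel
      -- support of `c'`: below the support of `c`, strictly below at `p*`
      have hsupp' : ∀ i U, c' i U ≠ 0 → ∃ S, S ⊆ U ∧ c i S ≠ 0 := by
        intro i U hU
        by_contra hcon
        push Not at hcon
        apply hU
        simp only [c']
        rw [Finset.sum_eq_zero (fun S hS => hcon S (Finset.mem_powerset.mp hS)), hcon U le_rfl]
        simp
      have hsupp'' : ∀ i U, c' i U ≠ 0 → p i = pstar → ∃ S, S ⊆ U ∧ S ≠ U ∧ c i S ≠ 0 := by
        intro i U hU hpi
        by_contra hcon
        push Not at hcon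
        apply hU
        simp only [c']
        rw [← Finset.sum_erase_add _ _ (Finset.mem_powerset.mpr (subset_refl U))]
        rw [Finset.sum_eq_zero (fun S hS => ?_)]
        · rw [hpi]; ring
        · rw [Finset.mem_erase, Finset.mem_powerset] at hS
          exact hcon S hS.2 hS.1
      have hInv' : ∀ i S, p i = 0 → c' i S ≠ 0 → S ≠ Finset.univ := by
        intro i U hpi hU
        obtain ⟨S, -, hS⟩ := hsupp' i U hU
        exact absurd hpi (hlog i S hS)
      have hlt : (Λ c').card < (Λ c).card := by
        -- a top pair at `p*`
        obtain ⟨x₁, hx₁, hmax⟩ := Finset.exists_max_image ((supp c).filter fun x => p x.1 = pstar) lvl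
          ⟨⟨i₀, S₀⟩, by simp [hsupp, hi₀, hpstar]⟩
        rw [Finset.mem_filter, hsupp] at hx₁
        refine hcard c c' hsupp' ⟨pstar, lvl x₁, (hΛ c _ _).mpr ⟨x₁, hx₁.1, hx₁.2, le_rfl⟩, fun hmem => ?_⟩
        rw [hΛ] at hmem
        obtain ⟨⟨i, U⟩, hU, hpi, hb⟩ := hmem
        obtain ⟨S, hSU, hSne, hS⟩ := hsupp'' i U hU hpi
        have hlt' : lvl ⟨i, U⟩ < lvl ⟨i, S⟩ := by
          simp only [lvl]
          have h1 : S.card < U.card := Finset.card_lt_card (Finset.ssubset_iff_subset_ne.mpr ⟨hSU, hSne⟩)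
          have h2 : U.card ≤ B i := by simpa using Finset.card_le_univ U
          omega
        have := hmax ⟨i, S⟩ (by simp [hsupp, hS, hpi])
        omega
      -- the new dominated pair `(Θ G − 2^{p*} G, y − 2^{p*} y)`
      have hGy' : (slabMap 0 1 (FreeAbelianGroup.lift T G) - (2 ^ pstar : ℕ) • G, y - (2 ^ pstar : ℕ) • y) ∈
          AddSubgroup.closure {v : Literature.NumberTheory.Transcendental.KZ.FormalRep × Literature.NumberTheory.Transcendental.KZ.FormalRep | ∃ (n : ℕ) (S : Literature.NumberTheory.Transcendental.KZ.IntegralRep (n + 1)) (r₀ g : Literature.NumberTheory.Transcendental.KZ.IntegralRep n), Literature.NumberTheory.Transcendental.KZ.IsDominatedFamily S r₀ g ∧ v = (Literature.NumberTheory.Transcendental.KZ.of S, Literature.NumberTheory.Transcendental.KZ.of r₀)} := by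
        have h1 := theta_mem_closure_dominatedPairs hμ T hT hGy
        have h2 := AddSubgroup.nsmul_mem _ hGy (2 ^ pstar)
        simpa using AddSubgroup.sub_mem _ h1 h2
      have hF' : D c' + (slabMap 0 1 (FreeAbelianGroup.lift T G) - (2 ^ pstar : ℕ) • G) ∈ fibredRelations := by
        have h1 : slabMap 0 1 (FreeAbelianGroup.lift T (D c + G)) - (2 ^ pstar : ℕ) • (D c + G) ∈ fibredRelations :=
          fibredRelations.sub_mem (hΘmem _ hF) (fibredRelations.nsmul_mem hF _)
        have h2 := fibredRelations.sub_mem h1 hDc'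
        convert h2 using 1
        simp only [map_add, smul_add]
        abel
      have hy' := ih c' (Nat.lt_succ_iff.mp (lt_of_lt_of_le hlt hN)) hInv' _ _ hGy' hF'
      -- divide by `2^{p*} − 1`
      have hy'' : ((2 ^ pstar - 1 : ℕ) : ℤ) • y ∈ relations := by
        have h := relations.neg_mem hy'
        have h1 : (1 : ℕ) ≤ 2 ^ pstar := Nat.one_le_two_pow
        rw [Nat.cast_sub h1]
        convert h using 1
        rw [sub_smul, ← natCast_zsmul y (2 ^ pstar)]
        simp
      refine mem_relations_of_zsmul_mem ?_ hy''
      have : 1 < 2 ^ pstar := Nat.one_lt_two_pow hpstar_pos.ne'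
      omega

end Main

/-- **Registered stub `stub_coreReduction_main`** (crux `CTConstruction`, line `registered`, reshape r3): explicit form of
the main induction `coreReduction_main`. [folklore] -/
theorem stub_coreReduction_main : ∀ (Q : ℕ), 0 < Q → (∀ (G y : Literature.NumberTheory.Transcendental.KZ.FormalRep), (G, y) ∈ AddSubgroup.closure {v : Literature.NumberTheory.Transcendental.KZ.FormalRep × Literature.NumberTheory.Transcendental.KZ.FormalRep | ∃ (n : ℕ) (S : Literature.NumberTheory.Transcendental.KZ.IntegralRep (n + 1)) (r₀ g : Literature.NumberTheory.Transcendental.KZ.IntegralRep n), Literature.NumberTheory.Transcendental.KZ.IsDominatedFamily S r₀ g ∧ v = (Literature.NumberTheory.Transcendental.KZ.of S, Literature.NumberTheory.Transcendental.KZ.of r₀)} → G ∈ Literature.NumberTheory.Transcendental.KZ.fibredRelations → y ∈ Literature.NumberTheory.Transcendental.KZ.relations) → (∀ (L : Literature.NumberTheory.Transcendental.KZ.IntegralRep 1), L.domain = {t | (1 / 2 : ℝ) ≤ t 0 ∧ t 0 ≤ 1} → L.integrand = (fun t => (t 0)⁻¹) → ∀ c : Literature.NumberTheory.Transcendental.KZ.FormalRep,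 Literature.NumberTheory.Transcendental.KZ.of L * c ∈ Literature.NumberTheory.Transcendental.KZ.relations → c ∈ Literature.NumberTheory.Transcendental.KZ.relations) → ∀ (k : ℕ) (p B d : Fin k → ℕ) (r : (i : Fin k) → Literature.NumberTheory.Transcendental.KZ.IntegralRep (d i)) (Rep : (i : Fin k) → Finset (Fin (B i)) → Literature.NumberTheory.Transcendental.KZ.IntegralRep (B i + d i + 1 + 1)), (∀ (i : Fin k) (S : Finset (Fin (B i))), (Rep i S).domain = {z | ∃ (s u : ℝ) (t : Fin (B i) → ℝ) (w : Fin (d i) → ℝ), z = Matrix.vecCons s (Matrix.vecCons u (Fin.append t w)) ∧ 0 < s ∧ s < 1 ∧ 0 < u ∧ u ^ Q * s ^ p i < 1 ∧ (∀ j, ((if j ∈ S then (1 / 2 : ℚ) ^ Q else 1 : ℚ) : ℝ) * s ^ (if j ∈ S then 0 else 1) ≤ t j ∧ t j ≤ 1) ∧ w ∈ (r i).domain}) → (∀ (i : Fin k) (S : Finset (Fin (B i))), (Rep i S).integrand = (fun z => (∏ j : Fin (B i), (z (Fin.castAdd (d i) j).succ.succ)⁻¹) * (r i).integrand (fun l :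 Fin (d i) => z (Fin.natAdd (B i) l).succ.succ))) → ∀ (T : (Σ n, Literature.NumberTheory.Transcendental.KZ.IntegralRep n) → Literature.NumberTheory.Transcendental.KZ.FormalRep), (∀ ρ : Literature.NumberTheory.Transcendental.KZ.IntegralRep 0, T ⟨0, ρ⟩ = 0) → (∀ (n : ℕ) (ρ : Literature.NumberTheory.Transcendental.KZ.IntegralRep (n + 1)), ∃ ρ' : Literature.NumberTheory.Transcendental.KZ.IntegralRep (n + 1), T ⟨n + 1, ρ⟩ = Literature.NumberTheory.Transcendental.KZ.of ρ' ∧ ρ'.domain = {z | Function.update z 0 ((((1 / 2 : ℚ) ^ Q : ℚ) : ℝ) * z 0) ∈ ρ.domain} ∧ ρ'.integrand = fun z => ρ.integrand (Function.update z 0 ((((1 / 2 : ℚ) ^ Q : ℚ) : ℝ) * z 0))) → ∀ (c : (i : Fin k) → Finset (Fin (B i)) → ℤ), (∀ i S, p i = 0 → c i S ≠ 0 → S ≠ Finset.univ) → ∀ (G y : Literature.NumberTheory.Transcendental.KZ.FormalRep), (G, y) ∈ AddSubgroup.closure {v : Literature.NumberTheory.Transcendental.KZ.FormalRep × Literature.NumberTheory.Transcendental.KZ.FormalRep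 | ∃ (n : ℕ) (S : Literature.NumberTheory.Transcendental.KZ.IntegralRep (n + 1)) (r₀ g : Literature.NumberTheory.Transcendental.KZ.IntegralRep n), Literature.NumberTheory.Transcendental.KZ.IsDominatedFamily S r₀ g ∧ v = (Literature.NumberTheory.Transcendental.KZ.of S, Literature.NumberTheory.Transcendental.KZ.of r₀)} → (∑ i, ∑ S : Finset (Fin (B i)), c i S • Literature.NumberTheory.Transcendental.KZ.of (Rep i S)) + G ∈ Literature.NumberTheory.Transcendental.KZ.fibredRelations → y ∈ Literature.NumberTheory.Transcendental.KZ.relations := by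
  intro Q hQ hPURE hL2C k p B d r Rep hRd hRi T hT0 hT c hInv G y hGy hF
  exact coreReduction_main hQ hPURE hL2C hRd hRi hT0 hT c hInv G y hGy hF

end Summit.KontsevichZagierPeriods.ValuedFieldSpecialisation
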